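import Mathlib.Data.Fin.VecNotation
import Mathlib.Data.Rat.Cast.Order
import Mathlib.Tactic.Linarith
import Mathlib.Tactic.NormNum
import Mathlib.Tactic.Ring
import Mathlib.Tactic.Positivity
import Mathlib.Tactic.FinCases
import HarnessLib

/-!
# Hub words over ℕ, III: a generic criterion — `curve(a,c)ᵀ Q curve(b,y) ≥ 0` on ℕ × ℕ from a finite 16 × 16 INTEGER table
# (Sahi programme, prover prim-sahi-p2 gen 64 — tool for THEOREM M; memo `FROM-prim-sahi-p2-gen64-ABPLUS-PROOF.md` §12)

Support file (`--supports stmt-CriticalPhenomena-4575`).  Standard axioms, no sorries, no named facts.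
`curveZ a c = (a₀, a₁2^c, a₂4^c, a₃5^c) ∈ ℤ⁴` for integer weights `a` (`a = (1,1,1,1)`: the hub pencil `w(c)`; `a = (0,1,3,4)`: the difference `w(c+1) − w(c)`).
`pairing_curveZ_nonneg`: if the integer bilinear form `BZ q` is `≥ 0` on the 16 × 16 vertex pairs (`vertZ a i`, `vertZ b j`) — eight small values `c < 8` and
eight tail-box vertices `(a₀ε₁, a₁2⁸ε₂, a₂4⁸ε₄, a₃5⁸)` — a `decide`-able fact — then `(curveZ a c)ᵀ q (curveZ b y) ≥ 0` for ALL `c, y ∈ ℕ` (pencil/box argument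
`boxlinZ` twice); `pairing_curve_nonneg` is the rational corollary for the matrix `q/den`. [this work]
-/

namespace Summit.CriticalPhenomena.PercolationContinuityZ3.Theorems.ProductFormHubWords

/-- Integer pencil/box lemma: `f₁ + f₂2^{8+m} + f₄4^{8+m} + f₅5^{8+m} ≥ 0` from the eight box-vertex inequalities at exponent `8`. [this work] -/
theorem boxlinZ (f1 f2 f4 f5 : ℤ) (m : ℕ)
    (v0 : 0 ≤ f5 * 5^8) (v1 : 0 ≤ f5 * 5^8 + f1) (v2 : 0 ≤ f5 * 5^8 + f2 * 2^8) (v4 : 0 ≤ f5 * 5^8 + f4 * 4^8)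
    (v12 : 0 ≤ f5 * 5^8 + f1 + f2 * 2^8) (v14 : 0 ≤ f5 * 5^8 + f1 + f4 * 4^8) (v24 : 0 ≤ f5 * 5^8 + f2 * 2^8 + f4 * 4^8)
    (v124 : 0 ≤ f5 * 5^8 + f1 + f2 * 2^8 + f4 * 4^8) :
    0 ≤ f1 + f2 * 2^(8+m) + f4 * 4^(8+m) + f5 * 5^(8+m) := by
  have h5 : (0:ℤ) ≤ 5^m := by positivity
  have h2 : (2:ℤ)^m ≤ 5^m := pow_le_pow_left₀ (by norm_num) (by norm_num) m
  have h4 : (4:ℤ)^m ≤ 5^m := pow_le_pow_left₀ (by norm_num) (by norm_num) m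
  have h1 : (1:ℤ) ≤ 5^m := one_le_pow₀ (by norm_num)
  have h2' : (0:ℤ) ≤ 2^m := by positivity
  have h4' : (0:ℤ) ≤ 4^m := by positivity
  rw [pow_add, pow_add, pow_add]
  rcases le_or_gt 0 f1 with s1 | s1 <;> rcases le_or_gt 0 f2 with s2 | s2 <;> rcases le_or_gt 0 f4 with s4 | s4
  · nlinarith [mul_nonneg v0 h5, mul_nonneg s2 h2', mul_nonneg s4 h4']
  · nlinarith [mul_nonneg v4 h5, mul_nonneg s2 h2', mul_le_mul_of_nonpos_left h4 s4.le]
  · nlinarith [mul_nonneg v2 h5, mul_nonneg s4 h4', mul_le_mul_of_nonpos_left h2 s2.le]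
  · nlinarith [mul_nonneg v24 h5, mul_le_mul_of_nonpos_left h2 s2.le, mul_le_mul_of_nonpos_left h4 s4.le]
  · nlinarith [mul_nonneg v1 h5, mul_nonneg s2 h2', mul_nonneg s4 h4', mul_le_mul_of_nonpos_left h1 s1.le]
  · nlinarith [mul_nonneg v14 h5, mul_nonneg s2 h2', mul_le_mul_of_nonpos_left h4 s4.le, mul_le_mul_of_nonpos_left h1 s1.le]
  · nlinarith [mul_nonneg v12 h5, mul_nonneg s4 h4', mul_le_mul_of_nonpos_left h2 s2.le, mul_le_mul_of_nonpos_left h1 s1.le]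
  · nlinarith [mul_nonneg v124 h5, mul_le_mul_of_nonpos_left h2 s2.le, mul_le_mul_of_nonpos_left h4 s4.le, mul_le_mul_of_nonpos_left h1 s1.le]

/-- Integer bilinear form `uᵀ q v` on `ℤ⁴` (explicit). [this work] -/
def BZ (q : Fin 4 → Fin 4 → ℤ) (u v : Fin 4 → ℤ) : ℤ :=
  u 0 * (q 0 0 * v 0 + q 0 1 * v 1 + q 0 2 * v 2 + q 0 3 * v 3) +
  u 1 * (q 1 0 * v 0 + q 1 1 * v 1 + q 1 2 * v 2 + q 1 3 * v 3) +
  u 2 * (q 2 0 * v 0 + q 2 1 * v 1 + q 2 2 * v 2 + q 2 3 * v 3) +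
  u 3 * (q 3 0 * v 0 + q 3 1 * v 1 + q 3 2 * v 2 + q 3 3 * v 3)

/-- Transposed matrix. [this work] -/
def trZ (q : Fin 4 → Fin 4 → ℤ) : Fin 4 → Fin 4 → ℤ := fun i j => q j i

/-- `BZ` is symmetric up to transposing the matrix. [this work] -/
theorem BZ_swap (q : Fin 4 → Fin 4 → ℤ) (u v : Fin 4 → ℤ) : BZ q u v = BZ (trZ q) v u := by
  simp only [BZ, trZ]; ring

/-- The integer-weighted pencil curve `(a₀, a₁2^c, a₂4^c, a₃5^c)`. [this work] -/
def curveZ (a : Fin 4 → ℤ) (c : ℕ) : Fin 4 → ℤ := ![a 0, a 1 * 2^c, a 2 * 4^c, a 3 * 5^c]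

/-- Integer tail-box vertex `(a₀ε₁, a₁2⁸ε₂, a₂4⁸ε₄, a₃5⁸)`. [this work] -/
def boxvZ (a : Fin 4 → ℤ) (e1 e2 e4 : ℤ) : Fin 4 → ℤ := ![a 0 * e1, a 1 * 2^8 * e2, a 2 * 4^8 * e4, a 3 * 5^8]

/-- The 16 integer vertices: `curveZ a c` for `c < 8`, then the 8 box vertices (bits of `i − 8`). [this work] -/
def vertZ (a : Fin 4 → ℤ) (i : Fin 16) : Fin 4 → ℤ :=
  if i.val < 8 then curveZ a i.val
  else boxvZ a (((i.val - 8) % 2 : ℕ) : ℤ) ((((i.val - 8) / 2) % 2 : ℕ) : ℤ) ((((i.val - 8) / 4) % 2 : ℕ) : ℤ)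

/-- Pencil form of `BZ` in the left argument. [this work] -/
theorem BZ_curveZ_left (q : Fin 4 → Fin 4 → ℤ) (a v : Fin 4 → ℤ) (c : ℕ) :
    BZ q (curveZ a c) v =
      a 0 * (q 0 0 * v 0 + q 0 1 * v 1 + q 0 2 * v 2 + q 0 3 * v 3)
      + a 1 * (q 1 0 * v 0 + q 1 1 * v 1 + q 1 2 * v 2 + q 1 3 * v 3) * 2^c
      + a 2 * (q 2 0 * v 0 + q 2 1 * v 1 + q 2 2 * v 2 + q 2 3 * v 3) * 4^c
      + a 3 * (q 3 0 * v 0 + q 3 1 * v 1 + q 3 2 * v 2 + q 3 3 * v 3) * 5^c := by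
  simp only [BZ, curveZ, Matrix.cons_val_zero, Matrix.cons_val_one, Matrix.cons_val]
  ring

/-- Box-vertex form of `BZ` in the left argument. [this work] -/
theorem BZ_boxvZ_left (q : Fin 4 → Fin 4 → ℤ) (a v : Fin 4 → ℤ) (e1 e2 e4 : ℤ) :
    BZ q (boxvZ a e1 e2 e4) v =
      a 0 * (q 0 0 * v 0 + q 0 1 * v 1 + q 0 2 * v 2 + q 0 3 * v 3) * e1
      + a 1 * (q 1 0 * v 0 + q 1 1 * v 1 + q 1 2 * v 2 + q 1 3 * v 3) * 2^8 * e2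
      + a 2 * (q 2 0 * v 0 + q 2 1 * v 1 + q 2 2 * v 2 + q 2 3 * v 3) * 4^8 * e4
      + a 3 * (q 3 0 * v 0 + q 3 1 * v 1 + q 3 2 * v 2 + q 3 3 * v 3) * 5^8 := by
  simp only [BZ, boxvZ, Matrix.cons_val_zero, Matrix.cons_val_one, Matrix.cons_val]
  ring

/-- Step 1: `BZ q (curveZ a c) v ≥ 0` for all `c` from the 16 left vertices (fixed right vector `v`). [this work] -/
theorem curveZ_left_nonneg (q : Fin 4 → Fin 4 → ℤ) (a v : Fin 4 → ℤ)
    (h : ∀ i : Fin 16, 0 ≤ BZ q (vertZ a i) v) (c : ℕ) : 0 ≤ BZ q (curveZ a c) v := by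
  rcases Nat.lt_or_ge c 8 with hc | hc
  · have hi := h ⟨c, by omega⟩
    have e : vertZ a ⟨c, by omega⟩ = curveZ a c := by simp [vertZ, hc]
    rw [e] at hi
    exact hi
  · obtain ⟨m, rfl⟩ := Nat.exists_eq_add_of_le hc
    rw [BZ_curveZ_left]
    have e8 := h 8; have e9 := h 9; have e10 := h 10; have e11 := h 11
    have e12 := h 12; have e13 := h 13; have e14 := h 14; have e15 := h 15
    rw [show vertZ a 8 = boxvZ a 0 0 0 from rfl, BZ_boxvZ_left] at e8
    rw [show vertZ a 9 = boxvZ a 1 0 0 from rfl, BZ_boxvZ_left] at e9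
    rw [show vertZ a 10 = boxvZ a 0 1 0 from rfl, BZ_boxvZ_left] at e10
    rw [show vertZ a 11 = boxvZ a 1 1 0 from rfl, BZ_boxvZ_left] at e11
    rw [show vertZ a 12 = boxvZ a 0 0 1 from rfl, BZ_boxvZ_left] at e12
    rw [show vertZ a 13 = boxvZ a 1 0 1 from rfl, BZ_boxvZ_left] at e13
    rw [show vertZ a 14 = boxvZ a 0 1 1 from rfl, BZ_boxvZ_left] at e14
    rw [show vertZ a 15 = boxvZ a 1 1 1 from rfl, BZ_boxvZ_left] at e15
    exact boxlinZ _ _ _ _ m (by linarith) (by linarith) (by linarith) (by linarith) (by linarith) (by linarith)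
      (by linarith) (by linarith)

/-- The criterion: a nonnegative 16 × 16 integer vertex table gives `(curveZ a c)ᵀ q (curveZ b y) ≥ 0` on all of `ℕ × ℕ`. [this work] -/
theorem pairing_curveZ_nonneg (q : Fin 4 → Fin 4 → ℤ) (a b : Fin 4 → ℤ)
    (htab : ∀ i j : Fin 16, 0 ≤ BZ q (vertZ a i) (vertZ b j)) (c y : ℕ) :
    0 ≤ BZ q (curveZ a c) (curveZ b y) := by
  -- step 1 in the left variable for each fixed right vertex, then step 1 again in the right variable (transposed form)
  have h1 : ∀ j : Fin 16, 0 ≤ BZ q (curveZ a c) (vertZ b j) := fun j =>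
    curveZ_left_nonneg q a (vertZ b j) (fun i => htab i j) c
  have h2 : ∀ j : Fin 16, 0 ≤ BZ (trZ q) (vertZ b j) (curveZ a c) := fun j => by rw [← BZ_swap]; exact h1 j
  have h3 := curveZ_left_nonneg (trZ q) b (curveZ a c) h2 y
  rw [← BZ_swap] at h3
  exact h3

/-- Rational bilinear form with matrix `q/den`, on ℚ⁴. [this work] -/
def BQ (q : Fin 4 → Fin 4 → ℤ) (den : ℚ) (u v : Fin 4 → ℚ) : ℚ :=
  (u 0 * ((q 0 0 : ℚ) * v 0 + (q 0 1 : ℚ) * v 1 + (q 0 2 : ℚ) * v 2 + (q 0 3 : ℚ) * v 3) +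
   u 1 * ((q 1 0 : ℚ) * v 0 + (q 1 1 : ℚ) * v 1 + (q 1 2 : ℚ) * v 2 + (q 1 3 : ℚ) * v 3) +
   u 2 * ((q 2 0 : ℚ) * v 0 + (q 2 1 : ℚ) * v 1 + (q 2 2 : ℚ) * v 2 + (q 2 3 : ℚ) * v 3) +
   u 3 * ((q 3 0 : ℚ) * v 0 + (q 3 1 : ℚ) * v 1 + (q 3 2 : ℚ) * v 2 + (q 3 3 : ℚ) * v 3)) / den

/-- The rational pencil curve `(a₀, a₁2^c, a₂4^c, a₃5^c) ∈ ℚ⁴`. [this work] -/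
def curve (a : Fin 4 → ℤ) (c : ℕ) : Fin 4 → ℚ := ![(a 0 : ℚ), (a 1 : ℚ) * 2^c, (a 2 : ℚ) * 4^c, (a 3 : ℚ) * 5^c]

/-- `BQ` on the rational curves is the cast of `BZ` on the integer curves, divided by `den`. [this work] -/
theorem BQ_curve_cast (q : Fin 4 → Fin 4 → ℤ) (den : ℚ) (a b : Fin 4 → ℤ) (c y : ℕ) :
    BQ q den (curve a c) (curve b y) = (BZ q (curveZ a c) (curveZ b y) : ℚ) / den := by
  simp only [BQ, BZ, curve, curveZ, Matrix.cons_val_zero, Matrix.cons_val_one, Matrix.cons_val]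
  push_cast; ring

/-- Rational corollary: a nonnegative integer vertex table and `den > 0` give `(curve a c)ᵀ (q/den) (curve b y) ≥ 0` for all `c, y ∈ ℕ`. [this work] -/
theorem pairing_curve_nonneg (q : Fin 4 → Fin 4 → ℤ) (den : ℚ) (hden : 0 < den) (a b : Fin 4 → ℤ)
    (htab : ∀ i j : Fin 16, 0 ≤ BZ q (vertZ a i) (vertZ b j)) (c y : ℕ) :
    0 ≤ BQ q den (curve a c) (curve b y) := by
  rw [BQ_curve_cast]
  exact div_nonneg (by exact_mod_cast pairing_curveZ_nonneg q a b htab c y) hden.le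

/-- Weight vector of the hub pencil `w(c) = (1, 2^c, 4^c, 5^c)`. [this work] -/
def wAZ : Fin 4 → ℤ := ![1, 1, 1, 1]

/-- Weight vector of the difference `w(c+1) − w(c) = (0, 2^c, 3·4^c, 4·5^c)`. [this work] -/
def wDZ : Fin 4 → ℤ := ![0, 1, 3, 4]

end Summit.CriticalPhenomena.PercolationContinuityZ3.Theorems.ProductFormHubWords
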